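import Summits.Ventures.DiscreteObjects.Hadamard.AutomorphismTransfer668

/-!
# Orbit normal form of a permutation with `π⁶ = 1` and `π³` fixed-point-free (6-cycles ⊔ 2-cycles)

Framing: lottery ticket; floor = certified bounds/negative ranges.

Cell pub-namedobj (venture DiscreteObjects), target (H), hadamard gen 14; combinatorial input of the ORDER-6 analysis
(HANDOFF-H-g13 open item 3).  For a permutation `π` of a finite linearly ordered type with `π⁶ = 1` and `π³` fixed-point-free,
every cycle has length `6` or `2`; with `R₆ = {c | π² c ≠ c, c = min of its orbit}` and `R₂ = {c | π² c = c, c = min of its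
orbit}` (minimality written as `∀ p : Fin 6, c ≤ π^p c`), the map `(p, c) ↦ π^p c` is a bijection
`(Fin 6 × R₆) ⊕ (Fin 2 × R₂) → ι` (**`perm62_bijective`**) intertwining the shift `p ↦ p + 1` with `π`.  Also
`perm6_pow_inj` (no short returns on a 6-cycle) and `perm_pow_mod_six`.  Generalises `orbit4_bijective` (gen 13).
Elementary; ours; no `sorry`.
-/

namespace Summit.Ventures.DiscreteObjects.Hadamard

open Finset

section orbit6
variable {ι : Type*} (π : Equiv.Perm ι)

/-- powers of `π` reduce mod `6` when `π⁶ = 1` pointwise -/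
theorem perm_pow_mod_six (hπ6 : ∀ i, π (π (π (π (π (π i))))) = i) (n : ℕ) (i : ι) :
    (π ^ n) i = (π ^ (n % 6)) i := by
  have h6 : π ^ 6 = 1 := by
    ext j; simp [pow_succ, hπ6]
  conv_lhs => rw [← Nat.div_add_mod n 6, pow_add, pow_mul, h6, one_pow, one_mul]

/-- **No short returns on a 6-cycle**: if `π⁶ = 1`, `π c ≠ c`, `π² c ≠ c`, `π³ c ≠ c`, then `π^p c = π^{p'} c` for
`p, p' < 6` forces `p = p'`. -/
theorem perm6_pow_inj (hπ6 : ∀ i, π (π (π (π (π (π i))))) = i) (c : ι) (h1 : π c ≠ c) (h2 : π (π c) ≠ c)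
    (h3 : π (π (π c)) ≠ c) (p p' : Fin 6) (h : (π ^ (p : ℕ)) c = (π ^ (p' : ℕ)) c) : p = p' := by
  have h4 : π (π (π (π c))) ≠ c := by
    intro h4c
    apply h2
    have e := congrArg (fun x => π (π x)) h4c
    simp only [hπ6] at e
    exact e.symm
  have h5 : π (π (π (π (π c)))) ≠ c := by
    intro h5c
    apply h1
    have e := congrArg (fun x => π x) h5c
    simp only [hπ6] at e
    exact e.symm
  fin_cases p <;> fin_cases p' <;> simp [pow_succ] at h ⊢
  all_goals first
    | exact absurd h h1 | exact absurd h.symm h1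
    | exact absurd h h2 | exact absurd h.symm h2
    | exact absurd h h3 | exact absurd h.symm h3
    | exact absurd h h4 | exact absurd h.symm h4
    | exact absurd h h5 | exact absurd h.symm h5

variable [LinearOrder ι] [Fintype ι]

/-- **Orbit normal form** of a permutation `π` with `π⁶ = 1` and `π³` fixed-point-free: with `R₆`, `R₂` the orbit minima of the
`6`-cycles resp. `2`-cycles, `(p, c) ↦ π^p c` is a bijection `(Fin 6 × R₆) ⊕ (Fin 2 × R₂) → ι`. -/
theorem perm62_bijective (hπ6 : ∀ i, π (π (π (π (π (π i))))) = i) (hπ3 : ∀ i, π (π (π i)) ≠ i) :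
    Function.Bijective (Sum.elim
      (fun x : Fin 6 × {c // c ∈ univ.filter (fun c => π (π c) ≠ c ∧ ∀ p : Fin 6, c ≤ (π ^ (p : ℕ)) c)} =>
        (π ^ (x.1 : ℕ)) x.2.1)
      (fun x : Fin 2 × {c // c ∈ univ.filter (fun c => π (π c) = c ∧ ∀ p : Fin 6, c ≤ (π ^ (p : ℕ)) c)} =>
        (π ^ (x.1 : ℕ)) x.2.1)) := by
  have h1 : ∀ i, π i ≠ i := fun i h => hπ3 i (by rw [h, h, h])
  -- the orbit minimum
  have hO : ∀ i, ∃ m, (∃ p : Fin 6, m = (π ^ (p : ℕ)) i) ∧ ∀ p : Fin 6, m ≤ (π ^ (p : ℕ)) i := by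
    intro i
    have hne : (univ.image (fun p : Fin 6 => (π ^ (p : ℕ)) i)).Nonempty :=
      ⟨i, mem_image.mpr ⟨0, mem_univ _, by simp⟩⟩
    refine ⟨(univ.image (fun p : Fin 6 => (π ^ (p : ℕ)) i)).min' hne, ?_, ?_⟩
    · obtain ⟨p, -, hp⟩ := mem_image.mp ((univ.image (fun p : Fin 6 => (π ^ (p : ℕ)) i)).min'_mem hne)
      exact ⟨p, hp.symm⟩
    · intro p
      exact Finset.min'_le _ _ (mem_image.mpr ⟨p, mem_univ _, rfl⟩)
  choose M hMmem hMle using hO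
  -- wrap-around
  have W1 : ∀ (p : Fin 6) (i : ι), ∃ p' : Fin 6, (π ^ (p : ℕ)) (π i) = (π ^ (p' : ℕ)) i := by
    intro p i
    fin_cases p
    · exact ⟨1, by simp⟩
    · exact ⟨2, by simp [pow_succ]⟩
    · exact ⟨3, by simp [pow_succ]⟩
    · exact ⟨4, by simp [pow_succ]⟩
    · exact ⟨5, by simp [pow_succ]⟩
    · exact ⟨0, by simp [pow_succ, hπ6]⟩
  have W2 : ∀ (p : Fin 6) (i : ι), ∃ p' : Fin 6, (π ^ (p : ℕ)) i = (π ^ (p' : ℕ)) (π i) := by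
    intro p i
    fin_cases p
    · exact ⟨5, by simp [pow_succ, hπ6]⟩
    · exact ⟨0, by simp⟩
    · exact ⟨1, by simp [pow_succ]⟩
    · exact ⟨2, by simp [pow_succ]⟩
    · exact ⟨3, by simp [pow_succ]⟩
    · exact ⟨4, by simp [pow_succ]⟩
  have hMπ : ∀ i, M (π i) = M i := by
    intro i
    apply le_antisymm
    · obtain ⟨p, hp⟩ := hMmem i
      obtain ⟨p', hp'⟩ := W2 p i
      rw [hp, hp']
      exact hMle (π i) p'
    · obtain ⟨p, hp⟩ := hMmem (π i)
      obtain ⟨p', hp'⟩ := W1 p i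
      rw [hp, hp']
      exact hMle i p'
  have hMpow : ∀ (n : ℕ) (i : ι), M ((π ^ n) i) = M i := by
    intro n
    induction n with
    | zero => intro i; simp
    | succ n ih => intro i; rw [pow_succ', Equiv.Perm.mul_apply, hMπ, ih]
  have hMfix : ∀ i, M (M i) = M i := by
    intro i
    obtain ⟨p, hp⟩ := hMmem i
    have e := hMpow p i
    rw [← hp] at e
    exact e
  have hrep : ∀ c, (∀ p : Fin 6, c ≤ (π ^ (p : ℕ)) c) ↔ M c = c := by
    intro c
    constructor
    · intro h
      apply le_antisymm
      · simpa using hMle c 0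
      · obtain ⟨p, hp⟩ := hMmem c
        rw [hp]
        exact h p
    · intro h p
      have e := hMle c p
      rwa [h] at e
  have hMrep : ∀ i, ∀ p : Fin 6, M i ≤ (π ^ (p : ℕ)) (M i) := fun i => (hrep (M i)).mpr (hMfix i)
  -- reduction mod 2 on a 2-cycle
  have hred : ∀ (p : Fin 6) (m : ι), π (π m) = m → ∃ p' : Fin 2, (π ^ (p : ℕ)) m = (π ^ (p' : ℕ)) m := by
    intro p m hm
    fin_cases p
    · exact ⟨0, by simp⟩
    · exact ⟨1, by simp⟩
    · exact ⟨0, by simp [pow_succ, hm]⟩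
    · exact ⟨1, by simp [pow_succ, hm]⟩
    · exact ⟨0, by simp [pow_succ, hm]⟩
    · exact ⟨1, by simp [pow_succ, hm]⟩
  constructor
  · rintro (⟨p, c, hc⟩ | ⟨p, c, hc⟩) (⟨p', c', hc'⟩ | ⟨p', c', hc'⟩) h
    · -- 6-cycle / 6-cycle
      simp only [Sum.elim_inl] at h
      have hcR := (mem_filter.mp hc).2
      have hc'R := (mem_filter.mp hc').2
      have hcc : c = c' := by
        have e1 := hMpow p c
        have e2 := hMpow p' c'
        rw [h] at e1
        rw [e1, (hrep c).mp hcR.2, (hrep c').mp hc'R.2] at e2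
        exact e2
      subst hcc
      have hp : p = p' := perm6_pow_inj π hπ6 c (h1 c) hcR.1 (hπ3 c) p p' h
      rw [hp]
    · -- 6-cycle / 2-cycle
      exfalso
      simp only [Sum.elim_inl, Sum.elim_inr] at h
      have hcR := (mem_filter.mp hc).2
      have hc'R := (mem_filter.mp hc').2
      have hcc : c = c' := by
        have e1 := hMpow p c
        have e2 := hMpow p' c'
        rw [h] at e1
        rw [e1, (hrep c).mp hcR.2, (hrep c').mp hc'R.2] at e2
        exact e2
      subst hcc
      exact hcR.1 hc'R.1
    · -- 2-cycle / 6-cycle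
      exfalso
      simp only [Sum.elim_inl, Sum.elim_inr] at h
      have hcR := (mem_filter.mp hc).2
      have hc'R := (mem_filter.mp hc').2
      have hcc : c = c' := by
        have e1 := hMpow p c
        have e2 := hMpow p' c'
        rw [h] at e1
        rw [e1, (hrep c).mp hcR.2, (hrep c').mp hc'R.2] at e2
        exact e2
      subst hcc
      exact hc'R.1 hcR.1
    · -- 2-cycle / 2-cycle
      simp only [Sum.elim_inr] at h
      have hcR := (mem_filter.mp hc).2
      have hc'R := (mem_filter.mp hc').2
      have hcc : c = c' := by
        have e1 := hMpow p c
        have e2 := hMpow p' c'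
        rw [h] at e1
        rw [e1, (hrep c).mp hcR.2, (hrep c').mp hc'R.2] at e2
        exact e2
      subst hcc
      have hp : p = p' := by
        fin_cases p <;> fin_cases p' <;> simp [pow_succ] at h ⊢
        · exact absurd h.symm (h1 c)
        · exact absurd h (h1 c)
      rw [hp]
  · intro i
    obtain ⟨p, hp⟩ := hMmem i
    obtain ⟨p', hp'⟩ : ∃ p' : Fin 6, i = (π ^ (p' : ℕ)) (M i) := by
      rw [hp]
      fin_cases p
      · exact ⟨0, by simp⟩
      · exact ⟨5, by simp [pow_succ, hπ6]⟩
      · exact ⟨4, by simp [pow_succ, hπ6]⟩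
      · exact ⟨3, by simp [pow_succ, hπ6]⟩
      · exact ⟨2, by simp [pow_succ, hπ6]⟩
      · exact ⟨1, by simp [pow_succ, hπ6]⟩
    by_cases h2 : π (π (M i)) = M i
    · have hmem : M i ∈ univ.filter (fun c => π (π c) = c ∧ ∀ p : Fin 6, c ≤ (π ^ (p : ℕ)) c) :=
        mem_filter.mpr ⟨mem_univ _, h2, hMrep i⟩
      obtain ⟨p'', hp''⟩ := hred p' (M i) h2
      exact ⟨Sum.inr (p'', ⟨M i, hmem⟩), by simp only [Sum.elim_inr]; rw [← hp'', ← hp']⟩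
    · have hmem : M i ∈ univ.filter (fun c => π (π c) ≠ c ∧ ∀ p : Fin 6, c ≤ (π ^ (p : ℕ)) c) :=
        mem_filter.mpr ⟨mem_univ _, h2, hMrep i⟩
      exact ⟨Sum.inl (p', ⟨M i, hmem⟩), by simp only [Sum.elim_inl]; rw [← hp']⟩

/-- the `6`-cycle part of the orbit normal form: `(p, c) ↦ π^p c` is a bijection from `Fin 6 × R₆` onto the rows moved by
`π²`; in particular `#{i | π² i ≠ i} = 6 · |R₆|`. -/
theorem perm62_card_moved (hπ6 : ∀ i, π (π (π (π (π (π i))))) = i) (hπ3 : ∀ i, π (π (π i)) ≠ i) :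
    (univ.filter (fun i => π (π i) ≠ i)).card =
      6 * (univ.filter (fun c => π (π c) ≠ c ∧ ∀ p : Fin 6, c ≤ (π ^ (p : ℕ)) c)).card := by
  have hbij := perm62_bijective π hπ6 hπ3
  set R₆ := univ.filter (fun c => π (π c) ≠ c ∧ ∀ p : Fin 6, c ≤ (π ^ (p : ℕ)) c) with hR₆
  set R₂ := univ.filter (fun c => π (π c) = c ∧ ∀ p : Fin 6, c ≤ (π ^ (p : ℕ)) c) with hR₂
  -- π² commutes with powers of π
  have hcomm : ∀ (n : ℕ) (c : ι), π (π ((π ^ n) c)) = (π ^ n) (π (π c)) := by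
    intro n c
    have e : π * π * π ^ n = π ^ n * (π * π) := by
      rw [← pow_two, ← pow_add, ← pow_add, add_comm]
    have := congrArg (fun τ : Equiv.Perm ι => τ c) e
    simpa [Equiv.Perm.mul_apply] using this
  let ψ : Fin 6 × {c // c ∈ R₆} → {i // i ∈ univ.filter (fun i => π (π i) ≠ i)} := fun x =>
    ⟨(π ^ (x.1 : ℕ)) x.2.1, mem_filter.mpr ⟨mem_univ _, by
      rw [hcomm]
      intro h
      exact (mem_filter.mp x.2.2).2.1 ((π ^ (x.1 : ℕ)).injective h)⟩⟩
  have hψ : Function.Bijective ψ := by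
    constructor
    · rintro x x' h
      have h' : (π ^ (x.1 : ℕ)) x.2.1 = (π ^ (x'.1 : ℕ)) x'.2.1 := congrArg Subtype.val h
      have := hbij.1 (a₁ := Sum.inl x) (a₂ := Sum.inl x') (by simpa only [Sum.elim_inl] using h')
      exact Sum.inl_injective this
    · rintro ⟨i, hi⟩
      obtain ⟨x | x, hx⟩ := hbij.2 i
      · exact ⟨x, Subtype.ext (by simpa only [Sum.elim_inl] using hx)⟩
      · exfalso
        simp only [Sum.elim_inr] at hx
        have h2 := (mem_filter.mp x.2.2).2.1
        apply (mem_filter.mp hi).2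
        rw [← hx, hcomm, h2]
  have hcard := Fintype.card_of_bijective hψ
  rw [Fintype.card_prod, Fintype.card_fin, Fintype.card_coe, Fintype.card_coe] at hcard
  rw [← hcard]

end orbit6

end Summit.Ventures.DiscreteObjects.Hadamard
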